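import Mathlib
import HarnessLib
import Summits.NavierStokesRegularity.NavierStokesRegularity.Theorems.TypeILiouvilleStrainLedgerOsgoodAligned
import Summits.NavierStokesRegularity.NavierStokesRegularity.Theorems.SqueezeCycleExtremalBiaxialitySubcriticalGaugeStrainBound
import Literature.Analysis.FluidPDE.TypeIAncientMild

/-!
# TypeILiouvilleStrainLedgerOsgoodTypeIStrain — crux (L) stmt-NavierStokesRegularity-10661 `TypeIliouvilleL`,
# registered stub `stub_typeIAncientLiouville_knssGauge` (door stmt-4050): THE STRAIN-FORM AND ALIGNED OSGOOD FLOORS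
# ON THE STUB'S LITERAL CLASS — NO GRADIENT HYPOTHESIS, ANY SIGN OF THE STRETCHING MAJORANT

Helper for stmt-NavierStokesRegularity-10661 (`--supports`); theorems only, no definitions, no named-fact hypotheses;
closes no item; Navier–Stokes regularity is NOT proved here (leafhand seat of the EulerZoomLiouville route).
Sequel of `TypeILiouvilleStrainLedgerOsgoodTypeIGauge` (gradient-norm Osgood floor on the Type-I class).  The
gradient-norm hypothesis `(−τ)‖∇u‖ ≤ a ≤ A` served there only to bound the vorticity; on the Type-I class that bound is
FREE: the class-uniform KNSS gauge bound `exists_gauge_norm_fderiv_le_of_typeI` (`(−t)‖∇u(t,x)‖ ≤ K₀(C)`, KNSS 2009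
Prop. 4.1 + scaling) puts the vorticity of every Type-I ancient mild field at the scale-invariant rate
`‖ω(t,x)‖ ≤ ‖curl‖K₀/(−t)`.  Hence only the STRETCHING enters, in strain form or — sharper — read along the vorticity:

* `shiftedLedger_tendsto_zero` — the real-variable core: for `T < 0 < δ`, `a` continuous with divergent deficit
  `∫_s^T (1 − a)/(−τ) → +∞`, the shifted ledger `B/(δ−s) · exp ∫_s^T a(τ−δ)/(δ−τ) dτ → 0` (`s → −∞`).
* `typeI_eq_zero_of_strainDeficit_divergent` — **STRAIN-FORM OSGOOD FLOOR ON THE TYPE-I CLASS**: `IsTypeIAncientMild C u`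
  with `⟪∇u(τ,x)ξ,ξ⟫ ≤ (a(τ)/(−τ))‖ξ‖²` for `τ < T` (`a` continuous, ANY sign and size) and divergent deficit ⟹ `u ≡ 0`.
  Contains `TypeILiouvilleStrainLedgerTypeIGauge.typeI_eq_zero_of_stretching_le` (`a ≡ a₀ < 1`) and every temporally
  gauged cell (deficit `≥ δ log(−s) − O(1)`); new cells: `a = 1 − c/log(−τ)`, `a = 1 − 1/(log(−τ) log log(−τ))`, ….
* `typeI_eq_zero_of_alignedDeficit_divergent` — **ALIGNED OSGOOD FLOOR ON THE TYPE-I CLASS**: the same with the strain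
  read only along the vorticity, `⟪∇u(τ,x) ω, ω⟫ ≤ (a(τ)/(−τ))‖ω‖²` (Constantin's depletion quantity).
* `typeI_eq_zero_of_alignedStretching_le_one_sub_div_log` — aligned log cell `(−τ)σ ≤ 1 − c/log(−τ)`.
* `knssGauge_eq_zero_of_strainDeficit_divergent` / `knssGauge_eq_zero_of_alignedDeficit_divergent` /
  `knssGauge_eq_zero_of_alignedStretching_le_one_sub_div_log` — BY THE STUB'S VERBATIM BINDERS: the registered stub
  HOLDS on the aligned-Osgood-subcritical stratum.  RESIDUAL of door 4050 on this axis: Type-I ancient mild fields whose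
  ALIGNED stretching number `(−τ)⟪∇u ω̂, ω̂⟫` exceeds `1 − c/log(−τ)` at some vortical point below every `T`, for every
  `c > 0` — equivalently, whose aligned stretching deficit has a CONVERGENT integral against `dτ/(−τ)` for every
  continuous majorant.

HONEST LABEL: Grönwall bookkeeping on the tree's comparison theorems; the scale-invariant corner (aligned stretching
number `≡ 1`) = door 4050 stays open; nothing here proves a registered stub, (L), or NS regularity; rung 0.
[cite: KochNadirashviliSereginSverak2009, §1 (1.2), §4 Prop. 4.1 (4.10), Remark 6.1 (arXiv:0709.3599)] [cite: MajdaBertozziCUP2002, eq. (3.80)]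
[cite: Constantin1994, §2]
-/

noncomputable section
open MeasureTheory Filter Set Function Metric
open scoped Topology RealInnerProductSpace ENNReal NNReal
open Literature.Analysis Literature.Analysis.FluidPDE Literature.Analysis.UnboundedOperators
set_option linter.dupNamespace false
namespace Summit.NavierStokesRegularity.NavierStokesRegularity.Theorems.TypeILiouvilleStrainLedger

/-! ## §1 The real-variable core: the shifted ledger tends to zero -/

/-- **The shifted ledger.**  For `T < 0 < δ`, `a` continuous with `∫_s^T (1 − a(τ)) dτ/(−τ) → +∞` (`s → −∞`) and any
constant `B`: `B/(δ−s) · exp ∫_s^T a(τ−δ)/max(δ−τ, δ−T) dτ → 0` as `s → −∞`.  (For `s < T` the integral is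
`∫_{s−δ}^{T−δ} a(σ)/(−σ) dσ = log((δ−s)/(δ−T)) − ∫_{s−δ}^{T−δ} (1−a)/(−σ)`, and the shifted deficit still diverges.)
[folklore] -/
theorem shiftedLedger_tendsto_zero {T δ B : ℝ} (hT : T < 0) (hδ : 0 < δ) {a : ℝ → ℝ} (hac : Continuous a)
    (hdiv : Tendsto (fun s : ℝ => ∫ τ in s..T, (1 - a τ) / (-τ)) atBot atTop) :
    Tendsto (fun s : ℝ => B / (δ - s) * Real.exp (∫ τ in s..T, a (τ - δ) / max (δ - τ) (δ - T))) atBot (𝓝 0) := by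
  have hδT : 0 < δ - T := by linarith
  have hΛeq : ∀ τ, τ ≤ T → a (τ - δ) / max (δ - τ) (δ - T) = a (τ - δ) / (δ - τ) := fun τ hτ => by
    rw [max_eq_left (sub_le_sub_left hτ δ)]
  -- closed form for `s < T`
  have hclosed : ∀ s < T, B / (δ - s) * Real.exp (∫ τ in s..T, a (τ - δ) / max (δ - τ) (δ - T)) =
      B / (δ - T) * Real.exp (-(∫ σ in (s - δ)..(T - δ), (1 - a σ) / (-σ))) := by
    intro s hs
    have hds : 0 < δ - s := by linarith
    have hsT' : s - δ < T - δ := by linarith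
    have hT' : T - δ < 0 := by linarith
    have hcongr : ∫ τ in s..T, a (τ - δ) / max (δ - τ) (δ - T) = ∫ τ in s..T, a (τ - δ) / (-(τ - δ)) := by
      refine intervalIntegral.integral_congr fun τ hτ => ?_
      rw [uIcc_of_le hs.le] at hτ
      rw [hΛeq τ hτ.2, show -(τ - δ) = δ - τ by ring]
    have hshift : ∫ τ in s..T, a (τ - δ) / (-(τ - δ)) = ∫ σ in (s - δ)..(T - δ), a σ / (-σ) :=
      intervalIntegral.integral_comp_sub_right (fun σ => a σ / (-σ)) δ
    have hsplit : ∫ σ in (s - δ)..(T - δ), a σ / (-σ) =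
        ∫ σ in (s - δ)..(T - δ), (1 / (-σ) - (1 - a σ) / (-σ)) := by
      refine intervalIntegral.integral_congr fun σ _ => ?_
      rw [div_sub_div_same]; ring
    have hcont2 : ContinuousOn (fun σ : ℝ => (1 - a σ) / (-σ)) (uIcc (s - δ) (T - δ)) := by
      refine (continuousOn_const.sub hac.continuousOn).div continuousOn_id.neg fun σ hσ => ?_
      rw [uIcc_of_le hsT'.le] at hσ
      exact (neg_pos.2 (lt_of_le_of_lt hσ.2 hT')).ne'
    have hcont1 : ContinuousOn (fun σ : ℝ => 1 / (-σ)) (uIcc (s - δ) (T - δ)) := by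
      refine continuousOn_const.div continuousOn_id.neg fun σ hσ => ?_
      rw [uIcc_of_le hsT'.le] at hσ
      exact (neg_pos.2 (lt_of_le_of_lt hσ.2 hT')).ne'
    have hds' : δ - s ≠ 0 := hds.ne'
    have hdT' : δ - T ≠ 0 := hδT.ne'
    rw [hcongr, hshift, hsplit,
      intervalIntegral.integral_sub hcont1.intervalIntegrable hcont2.intervalIntegrable,
      integral_one_div_neg_eq_log hsT' hT', Real.exp_sub, Real.exp_sub,
      show -(s - δ) = δ - s by ring, show -(T - δ) = δ - T by ring, Real.exp_log hds, Real.exp_log hδT,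
      Real.exp_neg]
    field_simp
  -- divergence of the shifted deficit integral
  have hdiv' : Tendsto (fun s : ℝ => ∫ σ in (s - δ)..(T - δ), (1 - a σ) / (-σ)) atBot atTop := by
    have hT' : T - δ < 0 := by linarith
    have hcont : ContinuousOn (fun σ : ℝ => (1 - a σ) / (-σ)) (Iio 0) :=
      (continuousOn_const.sub hac.continuousOn).div continuousOn_id.neg fun σ hσ => (neg_pos.2 hσ).ne'
    have hii : ∀ p q : ℝ, p < 0 → q < 0 → IntervalIntegrable (fun σ : ℝ => (1 - a σ) / (-σ)) volume p q := by
      intro p q hp hq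
      refine (hcont.mono fun σ hσ => ?_).intervalIntegrable
      rcases le_total p q with h | h
      · rw [uIcc_of_le h] at hσ; exact lt_of_le_of_lt hσ.2 hq
      · rw [uIcc_of_ge h] at hσ; exact lt_of_le_of_lt hσ.2 hp
    have heq : ∀ s < T, ∫ σ in (s - δ)..(T - δ), (1 - a σ) / (-σ) =
        (∫ σ in (s - δ)..T, (1 - a σ) / (-σ)) - ∫ σ in (T - δ)..T, (1 - a σ) / (-σ) := by
      intro s hs
      rw [eq_sub_iff_add_eq]
      exact intervalIntegral.integral_add_adjacent_intervals (hii _ _ (by linarith) hT') (hii _ _ hT' hT)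
    have h0 : Tendsto (fun s : ℝ => s - δ) atBot atBot :=
      tendsto_atBot_atBot.2 fun b => ⟨b + δ, fun s hs => by linarith⟩
    have h1 : Tendsto (fun s : ℝ => ∫ σ in (s - δ)..T, (1 - a σ) / (-σ)) atBot atTop := hdiv.comp h0
    have h2 := tendsto_atTop_add_const_right atBot (-(∫ σ in (T - δ)..T, (1 - a σ) / (-σ))) h1
    refine h2.congr' ?_
    filter_upwards [eventually_lt_atBot T] with s hs
    rw [heq s hs]
    exact (sub_eq_add_neg _ _).symm
  have hexp : Tendsto (fun s : ℝ => B / (δ - T) *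
      Real.exp (-(∫ σ in (s - δ)..(T - δ), (1 - a σ) / (-σ)))) atBot (𝓝 0) := by
    have h := (Real.tendsto_exp_atBot.comp (tendsto_neg_atTop_atBot.comp hdiv')).const_mul (B / (δ - T))
    rw [mul_zero] at h
    exact h
  refine hexp.congr' ?_
  filter_upwards [eventually_lt_atBot T] with s hs
  exact (hclosed s hs).symm

/-! ## §2 The strain-form and aligned Osgood floors on the Type-I ancient mild class -/

/-- **STRAIN-FORM OSGOOD FLOOR ON THE TYPE-I CLASS.**  Let `u` be a Type-I ancient mild field (`IsTypeIAncientMild C u`)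
whose stretching form obeys `⟪∇u(τ,x)ξ,ξ⟫ ≤ (a(τ)/(−τ))‖ξ‖²` for all `τ < T < 0`, `x`, `ξ`, with `a` continuous (any
sign, any size).  If `∫_s^T (1 − a(τ)) dτ/(−τ) → +∞` as `s → −∞`, then `u ≡ 0`.  Proof: for `t < 0`, `δ = −t/2`, the
shift `V(τ) = u(τ−δ)` is in class P with vorticity `≤ ‖curl‖K₀(C)/(δ−τ)` (class-uniform gauge bound
`exists_gauge_norm_fderiv_le_of_typeI`) and strain majorant `a(τ−δ)/(δ−τ)`; its ledger tends to zero (§1), so `V` is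
constant (`const_of_pastLedger_tendsto_zero`); all slices of `u` are constant and the Oseen gauge kills them
(`IsTypeIAncientMild.eq_zero_of_slice_const`).
[cite: KochNadirashviliSereginSverak2009, §4 Prop. 4.1 (4.10), Remark 6.1 (arXiv:0709.3599)] [cite: MajdaBertozziCUP2002, eq. (3.80)] -/
theorem typeI_eq_zero_of_strainDeficit_divergent {C : ℝ}
    {u : ℝ → EuclideanSpace ℝ (Fin 3) → EuclideanSpace ℝ (Fin 3)} (hu : IsTypeIAncientMild C u)
    {T : ℝ} (hT : T < 0) {a : ℝ → ℝ} (hac : Continuous a)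
    (hstr : ∀ τ < T, ∀ x ξ : EuclideanSpace ℝ (Fin 3), ⟪fderiv ℝ (u τ) x ξ, ξ⟫ ≤ a τ / (-τ) * ‖ξ‖ ^ 2)
    (hdiv : Tendsto (fun s : ℝ => ∫ τ in s..T, (1 - a τ) / (-τ)) atBot atTop) :
    ∀ t < 0, ∀ x, u t x = 0 := by
  obtain ⟨K₀, hK₀⟩ := exists_gauge_norm_fderiv_le_of_typeI C
  have hslice : ∀ t < 0, ∃ b : EuclideanSpace ℝ (Fin 3), ∀ x, u t x = b := by
    intro t ht
    set δ : ℝ := -t / 2 with hδ_def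
    have hδ : 0 < δ := by rw [hδ_def]; linarith
    have htδ : t + δ < 0 := by rw [hδ_def]; linarith
    have hV : IsTypeIAncientMild C (fun τ => u (τ - δ)) := hu.comp_sub_right hδ.le
    have hc : ContinuousOn (uncurry fun τ x => u (τ - δ) x) (Iio 0 ×ˢ univ) := hV.continuousOn_uncurry
    have hK : ∃ K : ℝ, ∀ τ < 0, ∀ x, ‖u (τ - δ) x‖ ≤ K := by
      refine ⟨C / Real.sqrt δ, fun τ hτ x => (hu.norm_le (t := τ - δ) (by linarith) x).trans ?_⟩
      exact div_le_div_of_nonneg_left hu.nonneg (Real.sqrt_pos.2 hδ) (Real.sqrt_le_sqrt (by linarith))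
    have hd : ∀ τ < 0, IsWeaklyDivFree (u (τ - δ)) := fun τ hτ => hV.isWeaklyDivFree hτ
    have hm : ∀ s τ : ℝ, s < τ → τ < 0 → ∀ x,
        u (τ - δ) x = heatExtension (u (s - δ)) (τ - s) x -
          oseenDuhamel 1 s (fun σ x => u (σ - δ) x) (fun σ x => u (σ - δ) x) τ x :=
      fun s τ hsτ hτ x => hV.mild_eq_heatExtension hsτ hτ x
    have hδT : 0 < δ - T := by linarith
    have hden : ∀ τ : ℝ, max (δ - τ) (δ - T) ≠ 0 := fun τ => (lt_of_lt_of_le hδT (le_max_right _ _)).ne'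
    have hΛc : Continuous fun τ : ℝ => a (τ - δ) / max (δ - τ) (δ - T) :=
      (hac.comp (continuous_id.sub continuous_const)).div
        ((continuous_const.sub continuous_id).max continuous_const) hden
    have hΛeq : ∀ τ, τ ≤ T → a (τ - δ) / max (δ - τ) (δ - T) = a (τ - δ) / (δ - τ) := fun τ hτ => by
      rw [max_eq_left (sub_le_sub_left hτ δ)]
    have hstrV : ∀ τ < T, ∀ x ξ : EuclideanSpace ℝ (Fin 3),
        ⟪fderiv ℝ (u (τ - δ)) x ξ, ξ⟫ ≤ a (τ - δ) / max (δ - τ) (δ - T) * ‖ξ‖ ^ 2 := by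
      intro τ hτ x ξ
      have h := hstr (τ - δ) (by linarith) x ξ
      rwa [show -(τ - δ) = δ - τ by ring, ← hΛeq τ hτ.le] at h
    have hωV : ∀ τ < T, ∀ x : EuclideanSpace ℝ (Fin 3), ‖curl (u (τ - δ)) x‖ ≤ ‖curlCLM‖ * K₀ / (δ - τ) := by
      intro τ hτ x
      have hdτ : 0 < δ - τ := by linarith
      have h1 : ‖fderiv ℝ (u (τ - δ)) x‖ ≤ K₀ / (δ - τ) := by
        have h := hK₀ hu (τ - δ) (by linarith) x
        rw [show -(τ - δ) = δ - τ by ring] at h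
        rw [le_div_iff₀ hdτ, mul_comm]
        exact h
      calc ‖curl (u (τ - δ)) x‖ = ‖curlCLM (fderiv ℝ (u (τ - δ)) x)‖ := rfl
        _ ≤ ‖curlCLM‖ * ‖fderiv ℝ (u (τ - δ)) x‖ := ContinuousLinearMap.le_opNorm _ _
        _ ≤ ‖curlCLM‖ * (K₀ / (δ - τ)) := mul_le_mul_of_nonneg_left h1 (norm_nonneg curlCLM)
        _ = ‖curlCLM‖ * K₀ / (δ - τ) := by ring
    obtain ⟨b, hb⟩ := const_of_pastLedger_tendsto_zero (v := fun τ x => u (τ - δ) x) hc hK hd hm hT hΛc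
      (Ω := fun τ => ‖curlCLM‖ * K₀ / (δ - τ)) hstrV hωV (shiftedLedger_tendsto_zero hT hδ hac hdiv)
    refine ⟨b, fun x => ?_⟩
    have h := hb (t + δ) htδ x
    simp only [add_sub_cancel_right] at h
    exact h
  have hub : ∀ s < 0, ∀ y, u s y = u s 0 := by
    intro s hs y
    obtain ⟨b, hb⟩ := hslice s hs
    rw [hb y, hb 0]
  intro t ht x
  exact hu.eq_zero_of_slice_const hub ht x

/-- **ALIGNED OSGOOD FLOOR ON THE TYPE-I CLASS.**  The same with the stretching read ONLY ALONG THE VORTICITY: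
`IsTypeIAncientMild C u`, `⟪∇u(τ,x) ω, ω⟫ ≤ (a(τ)/(−τ))‖ω‖²` (`ω = curl u(τ,x)`) for all `τ < T < 0` and `x`, `a`
continuous of any sign, divergent deficit `∫_s^T (1 − a)/(−τ) → +∞` ⟹ `u ≡ 0` (aligned ledger Liouville
`const_of_pastAlignedLedger_tendsto_zero` on the shift). [cite: Constantin1994, §2] [cite: KochNadirashviliSereginSverak2009, §4 Prop. 4.1, Remark 6.1 (arXiv:0709.3599)] -/
theorem typeI_eq_zero_of_alignedDeficit_divergent {C : ℝ}
    {u : ℝ → EuclideanSpace ℝ (Fin 3) → EuclideanSpace ℝ (Fin 3)} (hu : IsTypeIAncientMild C u)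
    {T : ℝ} (hT : T < 0) {a : ℝ → ℝ} (hac : Continuous a)
    (hstr : ∀ τ < T, ∀ x : EuclideanSpace ℝ (Fin 3),
      ⟪fderiv ℝ (u τ) x (curl (u τ) x), curl (u τ) x⟫ ≤ a τ / (-τ) * ‖curl (u τ) x‖ ^ 2)
    (hdiv : Tendsto (fun s : ℝ => ∫ τ in s..T, (1 - a τ) / (-τ)) atBot atTop) :
    ∀ t < 0, ∀ x, u t x = 0 := by
  obtain ⟨K₀, hK₀⟩ := exists_gauge_norm_fderiv_le_of_typeI C
  have hslice : ∀ t < 0, ∃ b : EuclideanSpace ℝ (Fin 3), ∀ x, u t x = b := by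
    intro t ht
    set δ : ℝ := -t / 2 with hδ_def
    have hδ : 0 < δ := by rw [hδ_def]; linarith
    have htδ : t + δ < 0 := by rw [hδ_def]; linarith
    have hV : IsTypeIAncientMild C (fun τ => u (τ - δ)) := hu.comp_sub_right hδ.le
    have hc : ContinuousOn (uncurry fun τ x => u (τ - δ) x) (Iio 0 ×ˢ univ) := hV.continuousOn_uncurry
    have hK : ∃ K : ℝ, ∀ τ < 0, ∀ x, ‖u (τ - δ) x‖ ≤ K := by
      refine ⟨C / Real.sqrt δ, fun τ hτ x => (hu.norm_le (t := τ - δ) (by linarith) x).trans ?_⟩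
      exact div_le_div_of_nonneg_left hu.nonneg (Real.sqrt_pos.2 hδ) (Real.sqrt_le_sqrt (by linarith))
    have hd : ∀ τ < 0, IsWeaklyDivFree (u (τ - δ)) := fun τ hτ => hV.isWeaklyDivFree hτ
    have hm : ∀ s τ : ℝ, s < τ → τ < 0 → ∀ x,
        u (τ - δ) x = heatExtension (u (s - δ)) (τ - s) x -
          oseenDuhamel 1 s (fun σ x => u (σ - δ) x) (fun σ x => u (σ - δ) x) τ x :=
      fun s τ hsτ hτ x => hV.mild_eq_heatExtension hsτ hτ x
    have hδT : 0 < δ - T := by linarith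
    have hden : ∀ τ : ℝ, max (δ - τ) (δ - T) ≠ 0 := fun τ => (lt_of_lt_of_le hδT (le_max_right _ _)).ne'
    have hΛc : Continuous fun τ : ℝ => a (τ - δ) / max (δ - τ) (δ - T) :=
      (hac.comp (continuous_id.sub continuous_const)).div
        ((continuous_const.sub continuous_id).max continuous_const) hden
    have hΛeq : ∀ τ, τ ≤ T → a (τ - δ) / max (δ - τ) (δ - T) = a (τ - δ) / (δ - τ) := fun τ hτ => by
      rw [max_eq_left (sub_le_sub_left hτ δ)]
    have hstrV : ∀ τ < T, ∀ x : EuclideanSpace ℝ (Fin 3),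
        ⟪fderiv ℝ (u (τ - δ)) x (curl (u (τ - δ)) x), curl (u (τ - δ)) x⟫ ≤
          a (τ - δ) / max (δ - τ) (δ - T) * ‖curl (u (τ - δ)) x‖ ^ 2 := by
      intro τ hτ x
      have h := hstr (τ - δ) (by linarith) x
      rwa [show -(τ - δ) = δ - τ by ring, ← hΛeq τ hτ.le] at h
    have hωV : ∀ τ < T, ∀ x : EuclideanSpace ℝ (Fin 3), ‖curl (u (τ - δ)) x‖ ≤ ‖curlCLM‖ * K₀ / (δ - τ) := by
      intro τ hτ x
      have hdτ : 0 < δ - τ := by linarith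
      have h1 : ‖fderiv ℝ (u (τ - δ)) x‖ ≤ K₀ / (δ - τ) := by
        have h := hK₀ hu (τ - δ) (by linarith) x
        rw [show -(τ - δ) = δ - τ by ring] at h
        rw [le_div_iff₀ hdτ, mul_comm]
        exact h
      calc ‖curl (u (τ - δ)) x‖ = ‖curlCLM (fderiv ℝ (u (τ - δ)) x)‖ := rfl
        _ ≤ ‖curlCLM‖ * ‖fderiv ℝ (u (τ - δ)) x‖ := ContinuousLinearMap.le_opNorm _ _
        _ ≤ ‖curlCLM‖ * (K₀ / (δ - τ)) := mul_le_mul_of_nonneg_left h1 (norm_nonneg curlCLM)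
        _ = ‖curlCLM‖ * K₀ / (δ - τ) := by ring
    obtain ⟨b, hb⟩ := const_of_pastAlignedLedger_tendsto_zero (v := fun τ x => u (τ - δ) x) hc hK hd hm hT
      hΛc (Ω := fun τ => ‖curlCLM‖ * K₀ / (δ - τ)) hstrV hωV (shiftedLedger_tendsto_zero hT hδ hac hdiv)
    refine ⟨b, fun x => ?_⟩
    have h := hb (t + δ) htδ x
    simp only [add_sub_cancel_right] at h
    exact h
  have hub : ∀ s < 0, ∀ y, u s y = u s 0 := by
    intro s hs y
    obtain ⟨b, hb⟩ := hslice s hs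
    rw [hb y, hb 0]
  intro t ht x
  exact hu.eq_zero_of_slice_const hub ht x

/-- **ALIGNED LOG CELL ON THE TYPE-I CLASS.**  A Type-I ancient mild field whose aligned stretching number obeys
`(−τ)·⟪∇u(τ,x) ω, ω⟫ ≤ (1 − c/log(−τ))‖ω‖²` for all `τ < T < −1` and `x` (`c > 0`) vanishes identically (deficit
`c(log log(−s) − log log(−T)) → +∞`). [cite: Constantin1994, §2] [cite: KochNadirashviliSereginSverak2009, §4 (arXiv:0709.3599)] -/
theorem typeI_eq_zero_of_alignedStretching_le_one_sub_div_log {C : ℝ}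
    {u : ℝ → EuclideanSpace ℝ (Fin 3) → EuclideanSpace ℝ (Fin 3)} (hu : IsTypeIAncientMild C u)
    {T c : ℝ} (hT : T < -1) (hc0 : 0 < c)
    (hstr : ∀ τ < T, ∀ x : EuclideanSpace ℝ (Fin 3),
      (-τ) * ⟪fderiv ℝ (u τ) x (curl (u τ) x), curl (u τ) x⟫ ≤ (1 - c / Real.log (-τ)) * ‖curl (u τ) x‖ ^ 2) :
    ∀ t < 0, ∀ x, u t x = 0 := by
  have hT0 : T < 0 := by linarith
  have hT1 : 1 < -T := by linarith
  set a : ℝ → ℝ := fun τ => 1 - c / Real.log (max (-τ) (-T)) with ha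
  have hmax1 : ∀ τ : ℝ, 1 < max (-τ) (-T) := fun τ => lt_of_lt_of_le hT1 (le_max_right _ _)
  have hlogpos : ∀ τ : ℝ, 0 < Real.log (max (-τ) (-T)) := fun τ => Real.log_pos (hmax1 τ)
  have hac : Continuous a := by
    refine continuous_const.sub (continuous_const.div ?_ fun τ => (hlogpos τ).ne')
    exact (continuous_neg.max continuous_const).log fun τ => (lt_trans zero_lt_one (hmax1 τ)).ne'
  have haeq : ∀ τ, τ ≤ T → a τ = 1 - c / Real.log (-τ) := fun τ hτ => by
    simp only [ha, max_eq_left (neg_le_neg hτ)]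
  refine typeI_eq_zero_of_alignedDeficit_divergent hu hT0 hac (fun τ hτ x => ?_) ?_
  · have hτ0 : 0 < -τ := by linarith
    rw [haeq τ hτ.le, div_mul_eq_mul_div, le_div_iff₀ hτ0, mul_comm _ (-τ)]
    exact hstr τ hτ x
  · have hclosed : ∀ s < T, ∫ τ in s..T, (1 - a τ) / (-τ) =
        c * (Real.log (Real.log (-s)) - Real.log (Real.log (-T))) := by
      intro s hs
      rw [← integral_div_neg_mul_log_eq hs hT]
      refine intervalIntegral.integral_congr fun τ hτ => ?_
      rw [uIcc_of_le hs.le] at hτ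
      rw [haeq τ hτ.2, sub_sub_cancel, div_div, mul_comm]
    have hlim : Tendsto (fun s : ℝ => c * (Real.log (Real.log (-s)) - Real.log (Real.log (-T)))) atBot atTop := by
      refine Tendsto.const_mul_atTop hc0 (tendsto_atTop_add_const_right _ _ ?_)
      exact Real.tendsto_log_atTop.comp (Real.tendsto_log_atTop.comp tendsto_neg_atBot_atTop)
    refine hlim.congr' ?_
    filter_upwards [eventually_lt_atBot T] with s hs
    exact (hclosed s hs).symm

/-! ## §3 By the verbatim binders of the registered stub `stub_typeIAncientLiouville_knssGauge` -/

/-- The registered stub HOLDS on the strain-Osgood-subcritical stratum: its literal KNSS-gauge hypotheses plus a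
continuous `a` with `⟪∇u(τ,x)ξ,ξ⟫ ≤ (a(τ)/(−τ))‖ξ‖²` for `τ < T < 0` and divergent deficit give `u ≡ 0`.
[cite: KochNadirashviliSereginSverak2009, §4 p. 8 (arXiv:0709.3599)] -/
theorem knssGauge_eq_zero_of_strainDeficit_divergent (C : ℝ)
    (u : ℝ → EuclideanSpace ℝ (Fin 3) → EuclideanSpace ℝ (Fin 3))
    (hu : ContDiffOn ℝ (⊤ : ℕ∞) (Function.uncurry u) (Set.Iio 0 ×ˢ Set.univ) ∧
      (∀ t < 0, Literature.Analysis.FluidPDE.VectorCalculus.IsDivFree (u t)) ∧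
      (∀ s t : ℝ, s < t → t < 0 → ∀ x, u t x = Literature.Analysis.FluidPDE.heatFlow (u s) (t - s) x -
        ∫ τ in Set.Ioo s t, ∫ y, Literature.Analysis.FluidPDE.oseenKernel (t - τ) (x - y) (u τ y) (u τ y)) ∧
      Literature.Analysis.FluidPDE.HasTypeITimeDecay C u)
    {T : ℝ} (hT : T < 0) {a : ℝ → ℝ} (hac : Continuous a)
    (hstr : ∀ τ < T, ∀ x ξ : EuclideanSpace ℝ (Fin 3), ⟪fderiv ℝ (u τ) x ξ, ξ⟫ ≤ a τ / (-τ) * ‖ξ‖ ^ 2)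
    (hdiv : Tendsto (fun s : ℝ => ∫ τ in s..T, (1 - a τ) / (-τ)) atBot atTop) :
    ∀ t < 0, ∀ x, u t x = 0 :=
  typeI_eq_zero_of_strainDeficit_divergent (isTypeIAncientMild_iff.2 hu) hT hac hstr hdiv

/-- The registered stub HOLDS on the ALIGNED-Osgood-subcritical stratum: its literal hypotheses plus a continuous `a`
with `⟪∇u(τ,x) ω, ω⟫ ≤ (a(τ)/(−τ))‖ω‖²` (`ω = curl u(τ,x)`) for `τ < T < 0` and divergent deficit give `u ≡ 0`.  The
RESIDUAL of door 4050 on this axis is the Type-I class with CONVERGENT aligned deficit integral for every continuous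
majorant. [cite: Constantin1994, §2] [cite: KochNadirashviliSereginSverak2009, §4 p. 8 (arXiv:0709.3599)] -/
theorem knssGauge_eq_zero_of_alignedDeficit_divergent (C : ℝ)
    (u : ℝ → EuclideanSpace ℝ (Fin 3) → EuclideanSpace ℝ (Fin 3))
    (hu : ContDiffOn ℝ (⊤ : ℕ∞) (Function.uncurry u) (Set.Iio 0 ×ˢ Set.univ) ∧
      (∀ t < 0, Literature.Analysis.FluidPDE.VectorCalculus.IsDivFree (u t)) ∧
      (∀ s t : ℝ, s < t → t < 0 → ∀ x, u t x = Literature.Analysis.FluidPDE.heatFlow (u s) (t - s) x -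
        ∫ τ in Set.Ioo s t, ∫ y, Literature.Analysis.FluidPDE.oseenKernel (t - τ) (x - y) (u τ y) (u τ y)) ∧
      Literature.Analysis.FluidPDE.HasTypeITimeDecay C u)
    {T : ℝ} (hT : T < 0) {a : ℝ → ℝ} (hac : Continuous a)
    (hstr : ∀ τ < T, ∀ x : EuclideanSpace ℝ (Fin 3),
      ⟪fderiv ℝ (u τ) x (curl (u τ) x), curl (u τ) x⟫ ≤ a τ / (-τ) * ‖curl (u τ) x‖ ^ 2)
    (hdiv : Tendsto (fun s : ℝ => ∫ τ in s..T, (1 - a τ) / (-τ)) atBot atTop) :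
    ∀ t < 0, ∀ x, u t x = 0 :=
  typeI_eq_zero_of_alignedDeficit_divergent (isTypeIAncientMild_iff.2 hu) hT hac hstr hdiv

/-- The registered stub HOLDS on the aligned log cell: its literal hypotheses plus
`(−τ)·⟪∇u(τ,x) ω, ω⟫ ≤ (1 − c/log(−τ))‖ω‖²` for `τ < T < −1`, `x` (`c > 0`) give `u ≡ 0`.  Residual on this axis:
Type-I fields with a vortical point of ALIGNED stretching number `> 1 − c/log(−τ)` below every `T`, for every `c > 0`.
[cite: Constantin1994, §2] [cite: KochNadirashviliSereginSverak2009, §4 p. 8 (arXiv:0709.3599)] -/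
theorem knssGauge_eq_zero_of_alignedStretching_le_one_sub_div_log (C : ℝ)
    (u : ℝ → EuclideanSpace ℝ (Fin 3) → EuclideanSpace ℝ (Fin 3))
    (hu : ContDiffOn ℝ (⊤ : ℕ∞) (Function.uncurry u) (Set.Iio 0 ×ˢ Set.univ) ∧
      (∀ t < 0, Literature.Analysis.FluidPDE.VectorCalculus.IsDivFree (u t)) ∧
      (∀ s t : ℝ, s < t → t < 0 → ∀ x, u t x = Literature.Analysis.FluidPDE.heatFlow (u s) (t - s) x -
        ∫ τ in Set.Ioo s t, ∫ y, Literature.Analysis.FluidPDE.oseenKernel (t - τ) (x - y) (u τ y) (u τ y)) ∧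
      Literature.Analysis.FluidPDE.HasTypeITimeDecay C u)
    {T c : ℝ} (hT : T < -1) (hc0 : 0 < c)
    (hstr : ∀ τ < T, ∀ x : EuclideanSpace ℝ (Fin 3),
      (-τ) * ⟪fderiv ℝ (u τ) x (curl (u τ) x), curl (u τ) x⟫ ≤ (1 - c / Real.log (-τ)) * ‖curl (u τ) x‖ ^ 2) :
    ∀ t < 0, ∀ x, u t x = 0 :=
  typeI_eq_zero_of_alignedStretching_le_one_sub_div_log (isTypeIAncientMild_iff.2 hu) hT hc0 hstr

end Summit.NavierStokesRegularity.NavierStokesRegularity.Theorems.TypeILiouvilleStrainLedger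

end
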